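import Summits.CriticalPhenomena.SAWScalingLimit.Theorems.SAWRenewalTightnessSubseqIdentificationCompensatorEssUnbounded
import Summits.CriticalPhenomena.SAWScalingLimit.Theorems.SAWRenewalTightnessSubseqIdentificationRigidityOfLawPartsAvoid
import Summits.CriticalPhenomena.SAWScalingLimit.Theorems.SAWRenewalTightnessSubseqIdentificationTiltedLawIdentity
import Summits.CriticalPhenomena.SAWScalingLimit.Theorems.SAWRenewalTightnessSubseqIdentificationCompensatorFactorsAvoidance
import HarnessLib

/-!
# RS5 of line `boundary-area-law`: chordal SLE_κ, `0 < κ < 8/3`, violates the restriction identity at a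
# carved half-ball (UNCONDITIONAL)

Crux `SubseqIdentification` (stmt-CriticalPhenomena-0783), line `boundary-area-law`, registered stub RS5
`stub_sleRestrictionRigidityBelow` (stated by lead c4, reshape r-c4-7/8), PROVED: for `0 < κ < 8/3`, a
Dobrushin domain `D` with a flat window at `x₀` of radius `ρ₀` (away from the marked points), the carved
domain `D' = D ∖ B̄(x₀, r)` (`0 < r < ρ₀`) and the chordal SLE_κ laws `μ` of `D` and `μ'` of `D'`, the
RESTRICTION IDENTITY `μ'(T) · μ{dist(x₀, γ) ≥ r} = μ(T ∩ {dist(x₀, γ) ≥ r})` (all measurable `T`) FAILS.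
Glue (lead c4, p154031 `stub_sleRestrictionRigidityBelow_of_lawPartsAvoid`) over the three law-level
parts: L1 the tilted [LSW] Theorem 6.5 at law level (`stub_tiltedLawIdentity`, p152723), L2′ the
factorization of the compensator weight through the curve class on the avoidance event
(`compensatorFactorsThroughCurve_of_disjoint`, p153880), and L3 the essential unboundedness of the
compensator on the avoidance event (`stub_compensatorEssUnbounded`, lead c5, p160397 over p157732,
p158795, p157904, p160197): restriction identity + L1 + L2′ force `exp(−λ_κ L^A)` to be a.s. constant on
`{γ ∩ A = ∅}`, contradicting L3. This is the SLE-side input of the restriction pin of the line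
(`SubseqIdentification_of_restriction`: among SLE_κ, κ ≤ 8/3 reached through the one-sided lattice
rarity bound, only κ = 8/3 is compatible with the exact lattice restriction property of the SAW).
No named fact is used.

References: G. F. Lawler, O. Schramm, W. Werner, *Conformal restriction: the chordal case*, J. Amer.
Math. Soc. 16 (2003), Prop. 5.3, Thm. 6.5, §8.
-/

noncomputable section

open MeasureTheory Filter Topology Set Metric
open scoped NNReal ENNReal
open Literature.Probability.RandomPlanarGeometry
open Literature.Probability.Process (preWienerMeasure)
open UpperHalfPlane (upperHalfPlaneSet)

namespace Summit.CriticalPhenomena.SAWScalingLimit.Theorems.SubseqIdentification.BoundaryAreaLaw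

/-- **RS5 — RESTRICTION RIGIDITY OF CHORDAL SLE_κ BELOW 8/3 (registered stub of line
`boundary-area-law`, PROVED, unconditional).** For `0 < κ < 8/3` the SLE_κ laws of a Dobrushin domain
and of the domain carved by a closed half-ball at a flat window never satisfy the restriction identity.
[cite: LawlerSchrammWerner2003Restriction, Prop. 5.3 and Thm. 6.5] -/
theorem stub_sleRestrictionRigidityBelow :
    ∀ (κ : ℝ≥0), 0 < κ → κ < 8 / 3 →
      ∀ (D D' : DobrushinDomain) (μ μ' : Measure (CurveClass ℂ)) (x₀ : ℂ) (ρ₀ r : ℝ),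
        0 < r → r < ρ₀ →
        D.carrier ∩ Metric.ball x₀ ρ₀ = {z : ℂ | x₀.im < z.im} ∩ Metric.ball x₀ ρ₀ →
        ρ₀ ≤ dist x₀ (D.pt 0) → ρ₀ ≤ dist x₀ (D.pt 1) →
        D'.carrier = D.carrier \ Metric.closedBall x₀ r → D'.pt 0 = D.pt 0 → D'.pt 1 = D.pt 1 →
        IsSLELaw κ D μ → IsSLELaw κ D' μ' →
        ¬ ∀ T : Set (CurveClass ℂ), MeasurableSet T →
            μ' T * μ {c | r ≤ Metric.infDist x₀ c.range} =
              μ (T ∩ {c | r ≤ Metric.infDist x₀ c.range})  :=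
  stub_sleRestrictionRigidityBelow_of_lawPartsAvoid stub_tiltedLawIdentity
    compensatorFactorsThroughCurve_of_disjoint stub_compensatorEssUnbounded

end Summit.CriticalPhenomena.SAWScalingLimit.Theorems.SubseqIdentification.BoundaryAreaLaw

end
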